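import Literature.MathematicalPhysics.QuantumFieldTheory.Balaban1983to89.B9Thm313WholeDirInput
import Literature.MathematicalPhysics.QuantumFieldTheory.Balaban1983to89.B9Thm313WholeDirZ

/-!
# `Balaban1983to89.B9Thm313WholeDirInputZ` — [B9] Theorem 3.13 (p. 426), DIRECTION-INDEXED INPUT-HÖLDER lines (3.44), (3.45) of 𝔊 = 𝔓G₁ with the
# COARSE-FIELD LETTERS RE-CLASSED (Z-twin of `B9Thm313WholeDirInput`; R1-cls of the cell's located «C-LETTER-FLAT-AT-ONE»)

T. Bałaban, *Propagators for lattice gauge theories in a background field*, Commun. Math. Phys. **99** (1985) 389–434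
[`Balaban1985BackgroundPropagators`, "B9"]; [4] = T. Bałaban, *Propagators and renormalization transformations for lattice
gauge theories. II*, Commun. Math. Phys. **96** (1984) 223–250 [`Balaban1984PropagatorsII`].  statement-level skeleton of published
theorems with citation tags; proofs where landed; nothing here is a claim about the Yang–Mills mass gap.

THE POINT.  `B9Thm313WholeDirInput` (the per-direction-pair twin of `B9Thm313WholeInput`) reads ∇_νG₁Q\* ∕ Φ∇_νG₁Q\* out of the FLAT coarse class Z⁰ and
(QG₁Q\*)⁻¹ into Z^{len}, located unsatisfiable at the knit's flat pins.  Here the middle classes are the weighted `Z_{wZ}`, `Z_{len·wZ}` of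
`B9Thm313WholeZ` and the (2.60) passage is `B9Thm313WholeInputZ.hasMaj_transfer_weight`:
* `GG_input_of_piecesFZ` — (3.153) with a left factor E and a right factor F, the G₁Q\* piece out of `Z_{len·wZ}`, `hL : Letters313Z`;
* ★ `GG_input44m_of_lettersZ`, ★ `GG_input45m_of_lettersZ`, ★ `GG_input44Family_of_lettersZ`, ★ `GG_input45Family_of_lettersZ` — the statements of the flat
  versions over `Letters313Z ∕ Letters313DMZ`; SAME conclusions and constants `constI44 ∕ constI45`; proofs verbatim but for the weighted step and transfer.
`wZ ≡ 1` recovers the flat statements.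

HONEST SCOPE.  Nothing of print is asserted: the letters are HYPOTHESES of printed ∕ md shape; kernel-checked bookkeeping.  NOT a node discharge, NOT
summit progress; one finite lattice at a time; nothing continuum, nothing about the mass gap.  Cell `pub-ymgap` (HUMAN RULING D-0062), Track A node
N06 [B9], N06-ASSIGNMENT v1 row 21 (bundle F7), seat `pub-ymgap-dag-n06-l` (g14), 2026-08-27.  NEW file; nothing landed is modified.
-/

namespace Literature.MathematicalPhysics.QuantumFieldTheory.Balaban1983to89.B9Thm313WholeDirInputZ

open Literature.MathematicalPhysics.QuantumFieldTheory.Balaban1983to89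
open Finset B6RandomWalk B6RandomWalkHom B9Thm34Ext B9Thm37GlueCor36 B11SectG B9SectDSup
open B9Thm37AllNorms B9Thm37AllNormsInstances B9Thm312Whole B9Thm312WholeLeaf B9Thm312WholeLeft B9Thm313Whole B9Thm313WholeLeft
open B9RWSums343Holder B9Ineq347 B9Thm312WholeClasses B9Thm312WholeHolder B9Thm312WholeHHolder B9Thm313WholeHolder B9Thm313WholeInput
open B9RWSums346SecondDiff B9RWSums344InputFam B9Thm312WholeDir B9Thm313WholeDir
open B9Thm313WholeDirInput B9Thm313WholeZ B9Thm313WholeLeftZ B9Thm313WholeHolderZ B9Thm313WholeInputZ B9Thm313WholeDirZ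

noncomputable section

section OneMember

variable {g : B9.Geometry} {B : B9.Backgrounds} {X Y Z W PX PY P : Type}
variable [Fintype X] [Fintype Y] [Fintype Z] [Fintype W] [Fintype PX] [Fintype PY] [Fintype P] [Fintype g.Site]
variable {R₀ : ℝ} {H₀ : Prop}

/-! ## §1 (3.153) with outer factors, the G₁Q\* piece out of the weighted class; the per-pair input lines -/

/-- ★ **(3.153) WITH A LEFT FACTOR E AND A GENERIC RIGHT FACTOR F READ FROM AN INPUT CLASS** `bA` of V-functions (dominating the block sup norm of
`blkV`): E𝔊F = EG₁F − (EG₁Dv)(RDv\*G₁F) − (EG₁Q\*)(C₁QG₁F) (`E_GG_F_eq`), composed by `hasMaj_frakG_classes` with the classes bA → bC (output), `bP` (the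
W-Hölder class of RDv\*G₁F), Z^{(1)} and 𝔠_Z^{(1)} for C₁ (`Letters313.c1_1`): the E-dependent pieces EG₁F (K₄₄), EG₁Dv (K_D), EG₁Q\* (K_Q, out of 𝔠_Z^{(1)})
at the common rate ρ₂ are hypotheses; QG₁F is built from the sup entry G₁F (`entry2_of_step` at the rate r: Theorem 3.3's (3.42)₃-type entry of
G₀F `he2F` + the step on 𝔠⁽¹⁾), the domination `bA ≧ |·|` and the local letter Q (`q1`); provisos ρ₄ + 2σ ≦ ρ₂ ≦ r, ρ₂ + σ ≦ δ₃, r ≦ δ₀, r + σ ≦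
δ_K, θc < 1 (the F-abstraction of `B9Thm313WholeInput.GG_input_of_pieces`, F = ∇\*_U there).
[cite: Balaban1985BackgroundPropagators, Thm 3.13 p.426 + (3.153) p.426 + (3.44)–(3.45) p.398 + (3.132) p.422; Balaban1984PropagatorsII, Lemma 2.1 (2.61) p.234] -/
theorem GG_input_of_piecesFZ (hG : GeoOK g) {𝔬 : Ops g B X Y Z W} {U : B.Cfg} {P' V : Type} [Fintype V]
    {blkV : V → g.Site} {F : (V → ℝ) →ₗ[ℝ] (X → ℝ)}
    {bA : BlockNorm (toB6 g R₀ H₀) (V → ℝ)} {bP : BlockNorm (toB6 g R₀ H₀) (W → ℝ)} {bC : BlockNorm (toB6 g R₀ H₀) (P' → ℝ)}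
    {E : (X → ℝ) →ₗ[ℝ] (P' → ℝ)} {θ B₀ B₃ Br K44 KD KQ δ₀ δ₃ δK r ρ₂ ρ₄ σ c : ℝ}
    (hrow : RowSum (toB6 g R₀ H₀) σ c) (hc : 0 ≤ c) (hθ : 0 ≤ θ) (hB₀ : 0 ≤ B₀) (hB₃ : 0 ≤ B₃) (hBr : 0 ≤ Br) (hK44 : 0 ≤ K44)
    (hKD : 0 ≤ KD) (hKQ : 0 ≤ KQ) (hσ : 0 ≤ σ) (hρ₄ : 0 ≤ ρ₄) (hρ₄₂ : ρ₄ + 2 * σ ≤ ρ₂) (hρ₂r : ρ₂ ≤ r) (hρ₂₃ : ρ₂ + σ ≤ δ₃)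
    (hr : 0 ≤ r) (hr0 : r ≤ δ₀) (hrK : r + σ ≤ δK) (hq : θ * c < 1)
    (hK1 : HasMaj (cNorm R₀ H₀ 𝔬.blk hG.lenle 1) (cNorm R₀ H₀ 𝔬.blk hG.lenle 1) (𝔬.G0 U ∘ₗ (𝔬.Tpi U + 𝔬.T2 U))
      (fun a b => θ * Real.exp (-(δK * g.dist a b))))
    (he2F : HasMajorantHom (g := toB6 g R₀ H₀) blkV 𝔬.blk (𝔬.G0 U ∘ₗ F)
      (fun (a b : g.Site) => B₀ * g.len a * Real.exp (-(δ₀ * g.dist a b))))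
    {wZ : g.Site → ℝ} {hwZ : ∀ y, 0 < wZ y} (hL : Letters313Z 𝔬 R₀ H₀ hG wZ hwZ B₃ δ₃ U) (hI : Identities 𝔬 U)
    (hdom : ∀ (y : g.Site) (μ : V → ℝ), (BlockNorm.ofBlocks (toB6 g R₀ H₀) blkV).loc y μ ≤ bA.loc y μ)
    (hloc : ∀ (y : g.Site) (μ : V → ℝ), bA.IsLoc y μ → (BlockNorm.ofBlocks (toB6 g R₀ H₀) blkV).IsLoc y μ)
    (hRG : HasMaj bA bP (𝔬.R U ∘ₗ 𝔬.Dvstar U ∘ₗ 𝔬.G1 U ∘ₗ F) (fun a b => Br * Real.exp (-(δ₃ * g.dist a b))))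
    (hGop : HasMaj bA bC (E ∘ₗ (𝔬.G1 U ∘ₗ F)) (fun a b => K44 * Real.exp (-(ρ₂ * g.dist a b))))
    (hGD : HasMaj bP bC (E ∘ₗ (𝔬.G1 U ∘ₗ 𝔬.Dv U)) (fun a b => KD * Real.exp (-(ρ₂ * g.dist a b))))
    (hGQ : HasMaj (weightNorm (BlockNorm.ofBlocks (toB6 g R₀ H₀) 𝔬.blkZ) (fun y => g.len y * wZ y) fun y => (wZlen_pos hG hwZ y).le) bC
      (E ∘ₗ 𝔬.G1 U ∘ₗ 𝔬.Qstar U) (fun a b => KQ * Real.exp (-(ρ₂ * g.dist a b)))) :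
    HasMaj bA bC (E ∘ₗ (𝔬.GG U ∘ₗ F))
      (fun a b => (K44 + bP.κ * KD * Br * c + KQ * (B₃ * (B₃ * (B₀ * (1 - θ * c)⁻¹) * c) * c) * c) *
        Real.exp (-(ρ₄ * g.dist a b))) := by
  -- adapted from `B9Thm313WholeInput.GG_input_of_pieces` (∇\*_U ↦ F)
  have htri : Triangle254 (toB6 g R₀ H₀) := fun a b c => hG.tri a b c
  have hfix1 := fix_of_inverses hI.invG0' hI.invG1
  have hq1 : 0 ≤ (1 - θ * c)⁻¹ := inv_nonneg.mpr (by linarith)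
  have hA₁ : 0 ≤ B₀ * (1 - θ * c)⁻¹ := mul_nonneg hB₀ hq1
  have hρ₂0 : 0 ≤ ρ₂ := by linarith
  have hρ₂₃' : ρ₂ ≤ δ₃ := by linarith
  -- QG₁F : bA → Z^{(1)} — G₁F from the sup entry, the domination, the local letter Q
  have hm2 := entry2_of_step hG hrow hθ hB₀ hr hr0 hrK hK1 he2F hfix1 hq
  have h20 : HasMaj (BlockNorm.ofBlocks (toB6 g R₀ H₀) blkV) (BlockNorm.ofBlocks (toB6 g R₀ H₀) 𝔬.blk) (𝔬.G1 U ∘ₗ F)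
      (fun a b => B₀ * (1 - θ * c)⁻¹ * g.len a * Real.exp (-(r * g.dist a b))) :=
    hasMaj_of_hasMajorantHom (G := toB6 g R₀ H₀) blkV 𝔬.blk
      (fun a b => mul_nonneg (mul_nonneg hA₁ (hG.lenle a)) (Real.exp_nonneg _)) hm2
  have h2c : HasMaj (cNorm R₀ H₀ blkV hG.lenle 0) (cNorm R₀ H₀ 𝔬.blk hG.lenle 1) (𝔬.G1 U ∘ₗ F)
      (fun a b => B₀ * (1 - θ * c)⁻¹ * Real.exp (-(r * g.dist a b))) := by
    refine (hasMaj_cNorm_of_hasMaj hG 1 0 h20).mono fun y y' => le_of_eq ?_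
    have hy : g.len y ≠ 0 := (hG.lenpos y).ne'
    simp only [wt, pow_zero, pow_one, mul_one]
    rw [mul_assoc (B₀ * (1 - θ * c)⁻¹), mul_comm (g.len y), ← mul_assoc (B₀ * (1 - θ * c)⁻¹), mul_assoc,
      mul_inv_cancel₀ hy, mul_one]
  have h2o : HasMaj (BlockNorm.ofBlocks (toB6 g R₀ H₀) blkV) (cNorm R₀ H₀ 𝔬.blk hG.lenle 1) (𝔬.G1 U ∘ₗ F)
      (fun a b => B₀ * (1 - θ * c)⁻¹ * Real.exp (-(r * g.dist a b))) := by
    have h := hasMaj_toR_src hG h2c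
    simp only [Nat.cast_zero, neg_zero] at h
    exact hasMaj_of_in_zero h
  have h2A : HasMaj bA (cNorm R₀ H₀ 𝔬.blk hG.lenle 1) (𝔬.G1 U ∘ₗ F)
      (fun a b => B₀ * (1 - θ * c)⁻¹ * Real.exp (-(r * g.dist a b))) :=
    hasMaj_of_dom hdom hloc (fun a b => mul_nonneg hA₁ (Real.exp_nonneg _)) h2o
  have hQG : HasMaj bA (cNorm R₀ H₀ 𝔬.blkZ hG.lenle 1) (𝔬.Q U ∘ₗ (𝔬.G1 U ∘ₗ F))
      (fun a b => (cNorm R₀ H₀ 𝔬.blk hG.lenle 1 (X := X)).κ * B₃ * (B₀ * (1 - θ * c)⁻¹) * c *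
        Real.exp (-(ρ₂ * g.dist a b))) :=
    hasMaj_comp_exp htri hG.dnn hrow hB₃ hA₁ hρ₂0 hρ₂r hρ₂₃ hL.q1 h2A
  simp only [cNorm_κ, one_mul] at hQG
  -- C₁ : Z^{(1)} → Z_{len·wZ}
  have hC : HasMaj (cNorm R₀ H₀ 𝔬.blkZ hG.lenle 1) (weightNorm (BlockNorm.ofBlocks (toB6 g R₀ H₀) 𝔬.blkZ) (fun y => g.len y * wZ y) fun y => (wZlen_pos hG hwZ y).le)
      (𝔬.C1 U) (fun a b => B₃ * Real.exp (-(δ₃ * g.dist a b))) := hL.c1_1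
  have hBQ0 : 0 ≤ B₃ * (B₀ * (1 - θ * c)⁻¹) * c := mul_nonneg (mul_nonneg hB₃ hA₁) hc
  -- (3.153) composed
  have hfr := hasMaj_frakG_classes htri hG.dnn hrow hK44 hKD hBr hKQ hB₃ hBQ0 hρ₄ hσ hρ₄₂ hGop hGD
    (hRG.of_rate_le hG.dnn hBr hρ₂₃') hGQ (hC.of_rate_le hG.dnn hB₃ hρ₂₃') hQG
  have hGG := hfr.congr (T' := E ∘ₗ (𝔬.GG U ∘ₗ F)) fun μ => by rw [E_GG_F_eq hI E F]
  refine hGG.mono fun a b => le_of_eq ?_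
  simp only [cNorm_κ, weightNorm_ofBlocks_κ, one_mul, toB6_dist]

/-! ## §2 The two input-Hölder members of 𝔊 per direction pair, and the packages -/

omit [Fintype P] in
/-- ★ **(3.44) FOR 𝔊 = 𝔓G₁ PER DIRECTION PAIR, PRINTED SHAPE, COARSE LETTERS RE-CLASSED** (over `Letters313Z ∕ Letters313DMZ`, one free weight `wZ`) — ∇_{U,ν}𝔊∇\*_{U,μ} read from the input Hölder class `bHX ε` of X-functions into the block sup
norm of X: |(∇_{U,ν}𝔊∇\*_{U,μ}λ)(x)| ≦ K·e^{−ρ₄d(y,y′)}(‖λ‖_ε + |λ|) for x ∈ Δ(y), supp λ ⊂ Δ̃(y′), K = `constI44 θ θ_D θ_H θ_v B₀ B₃ B_i(ε) B_d(ε) B_r Λ κ_W c`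
(the sibling's constant).  Route: (3.153) with E = ∇_{U,ν}, F = ∇\*_{U,μ} (`GG_input_of_piecesF`); ∇_νG₁∇\*_μ and ∇_νG₁Dv by r1's right form (`input44_of_step` ∕
`input44_of_stepV` from Theorem 3.3's (3.44) per pair `Thm33G0Dir.h44m` ∕ the letter `Letters313IM.dgDvd`, the steps `StepDir.tDd1` ∕ `Letters313IM.tDv`,
the per-direction left entry ∇_{U,ν}G₁ of `B9Thm312WholeLeft.entry1_of_stepD` (`Thm33G0Dir.e1d`, `StepDir.sDd1`) transferred by (2.60)); ∇_νG₁Q\* by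
`hasMaj_left_right` (letters `Letters313DMZ.dgQsd`, `Letters313Z.gQs2`, class `Z_{wZ}`) transferred by (2.60) (`hasMaj_transfer_weight`) to
Z_{len·wZ} → 𝔠^{(0)}.  Provisos: ρ₄ + 3σ ≦ (1 − α)r, r ≦ δ₀, r ≦ δ₃,
r + σ ≦ δ_K, θc < 1 — the per-pair twin of `B9Thm313WholeInput.GG_input44_of_letters`.
[cite: Balaban1985BackgroundPropagators, Thm 3.13 p.426 + (3.153) p.426 + (3.44) p.398 + (3.39) p.397 + Thm 3.12 p.423 + p.398 (remark after (3.47)); Balaban1984PropagatorsII, Lemma 2.1 (2.60)–(2.61) p.234] -/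
theorem GG_input44m_of_lettersZ (hG : GeoOK g) (𝔭 : HolderProbes g B X Y PX PY) {𝔬 : Ops g B X Y Z W} {U : B.Cfg}
    {Dd Dds : B.Cfg → P → Module.End ℝ (X → ℝ)}
    {bHX : ℝ → BlockNorm (toB6 g R₀ H₀) (X → ℝ)} {bHW : ℝ → BlockNorm (toB6 g R₀ H₀) (W → ℝ)} {bH : BlockNorm (toB6 g R₀ H₀) (W → ℝ)}
    {Bh Bi Bq Bd : ℝ → ℝ} {Bi2 Bd2 : ℝ → ℝ → ℝ} {θ θD θH θv B₀ B₃ Br δ₀ δ₃ δK r ρ₄ α Λ σ c ε : ℝ} (hrow : RowSum (toB6 g R₀ H₀) σ c)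
    (hc : 0 ≤ c) (hθ : 0 ≤ θ) (hθD : 0 ≤ θD) (hθH : 0 ≤ θH) (hθv : 0 ≤ θv) (hB₀ : 0 ≤ B₀) (hB₃ : 0 ≤ B₃) (hBi : 0 ≤ Bi ε)
    (hBd : 0 ≤ Bd ε) (hBr : 0 ≤ Br) (hΛ : 0 ≤ Λ) (hα : 0 ≤ α) (hσ : 0 ≤ σ) (hε0 : 0 < ε) (hε1 : ε ≤ 1) (hρ₄ : 0 ≤ ρ₄)
    (hρ₄r : ρ₄ + 3 * σ ≤ (1 - α) * r) (hr : 0 ≤ r) (hr0 : r ≤ δ₀) (hr₃ : r ≤ δ₃) (hrK : r + σ ≤ δK) (hq : θ * c < 1)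
    (hST : ScaleTransfer g r α Λ (fun y => g.len y ^ (1 : ℝ)))
    (hK1 : HasMaj (cNorm R₀ H₀ 𝔬.blk hG.lenle 1) (cNorm R₀ H₀ 𝔬.blk hG.lenle 1) (𝔬.G0 U ∘ₗ (𝔬.Tpi U + 𝔬.T2 U))
      (fun a b => θ * Real.exp (-(δK * g.dist a b))))
    (hK2 : HasMaj (cNorm R₀ H₀ 𝔬.blk hG.lenle 2) (cNorm R₀ H₀ 𝔬.blk hG.lenle 2) (𝔬.G0 U ∘ₗ (𝔬.Tpi U + 𝔬.T2 U))
      (fun a b => θ * Real.exp (-(δK * g.dist a b))))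
    (he0 : HasMajorant (g := toB6 g R₀ H₀) 𝔬.blk (𝔬.G0 U) (fun a b => B₀ * g.len a ^ 2 * Real.exp (-(δ₀ * g.dist a b))))
    (hH0 : Thm33G0Dir 𝔬 𝔭 Dd Dds R₀ H₀ bHX B₀ Bh Bi Bi2 δ₀ U) (hHR : Thm33G0DirR 𝔬 Dds R₀ H₀ B₀ δ₀ U)
    (hSD : StepDir 𝔬 𝔭 Dd Dds R₀ H₀ bHX hG.lenle θD θH δK U)
    {wZ : g.Site → ℝ} {hwZ : ∀ y, 0 < wZ y}
    (hL : Letters313Z 𝔬 R₀ H₀ hG wZ hwZ B₃ δ₃ U) (hLDM : Letters313DMZ 𝔬 𝔭 Dd R₀ H₀ hG wZ hwZ B₃ Bq δ₃ bH U)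
    (hLIM : Letters313IM 𝔬 𝔭 Dd Dds R₀ H₀ hG.lenle bHX bHW Br θv Bd Bd2 δ₃ δK U) (hI : Identities 𝔬 U) (ν μ : P) :
    HasMaj (bHX ε) (BlockNorm.ofBlocks (toB6 g R₀ H₀) 𝔬.blk) (Dd U ν ∘ₗ (𝔬.GG U ∘ₗ Dds U μ))
      (fun (a b : g.Site) => constI44 θ θD θH θv B₀ B₃ (Bi ε) (Bd ε) Br Λ (bHW ε).κ c * Real.exp (-(ρ₄ * g.dist a b))) := by
  -- adapted from `B9Thm313WholeInput.GG_input44_of_letters` (direction letters, X-inputs)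
  have hfix1 := fix_of_inverses hI.invG0' hI.invG1
  have hfixR := fix_right_of_inverses hI.invG0' hI.invG1
  have hq1 : 0 ≤ (1 - θ * c)⁻¹ := inv_nonneg.mpr (by linarith)
  have hA₁ : 0 ≤ B₀ * (1 - θ * c)⁻¹ := mul_nonneg hB₀ hq1
  have hA₃ : 0 ≤ B₃ * (1 - θ * c)⁻¹ := mul_nonneg hB₃ hq1
  have hCL : 0 ≤ B₀ + θD * (B₀ * (1 - θ * c)⁻¹) * c := add_nonneg hB₀ (mul_nonneg (mul_nonneg hθD hA₁) hc)
  have hKQ' : 0 ≤ B₃ + θD * (B₃ * (1 - θ * c)⁻¹) * c := add_nonneg hB₃ (mul_nonneg (mul_nonneg hθD hA₃) hc)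
  -- rates
  have h1α : (1 - α) * r ≤ r := by rw [sub_mul, one_mul]; exact sub_le_self _ (mul_nonneg hα hr)
  have hρ₂0 : 0 ≤ ρ₄ + 2 * σ := by linarith
  have hρ₂σ : ρ₄ + 2 * σ + σ ≤ (1 - α) * r := by linarith
  have hρ₂α : ρ₄ + 2 * σ ≤ (1 - α) * r := by linarith
  have hρ₂r : ρ₄ + 2 * σ ≤ r := by linarith
  have hρ₂K : ρ₄ + 2 * σ ≤ δK := by linarith
  have hρ₂0' : ρ₄ + 2 * σ ≤ δ₀ := by linarith
  have hρ₂₃ : ρ₄ + 2 * σ ≤ δ₃ := by linarith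
  have hρ₂₃σ : ρ₄ + 2 * σ + σ ≤ δ₃ := by linarith
  -- the per-direction left entry ∇_{U,ν}G₁ at the rate r
  have hm1 := entry1_of_stepD hG hrow hθ hθD hB₀ hr hr0 hrK hK2 (hSD.sDd1 ν) he0 (hH0.e1d ν) hfix1 hq
  -- ∇_νG₁∇*_μ from `bHX ε` and ∇_νG₁Dv from `bHW ε` by the right form
  have hGop := input44_of_step hG hrow hθH hBi hCL hΛ hρ₂0 hρ₂σ hρ₂K hρ₂0' hST hm1 (hH0.h44m (ν, μ) ε hε0 hε1)
    (hSD.tDd1 μ ε hε0) hfixR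
  have hGD := input44_of_stepV hG hrow hθv hBd hCL hΛ hρ₂0 hρ₂σ hρ₂K hρ₂₃ hST hm1 (hLIM.dgDvd ν ε hε0 hε1) (hLIM.tDv ε hε0)
    hfixR
  -- ∇_νG₁Q* : Z_{wZ} → 𝔠⁽¹⁾ by the left form, then (2.60) for the weighted source: Z_{len·wZ} → 𝔠^{(0)}
  have hGQr := hasMaj_right_of_step_weight hG hwZ hrow hθ hB₃ hr hr₃ hrK hK2 hL.gQs2 hfix1 hq
  have hDQ := hasMaj_left_right hG hrow hθD hB₃ hA₃ hr hr₃ le_rfl hrK (hSD.sDd1 ν) (hLDM.dgQsd ν) hGQr hfix1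
  have hDQR : HasMaj (weightNorm (BlockNorm.ofBlocks (toB6 g R₀ H₀) 𝔬.blkZ) wZ fun y => (hwZ y).le) (cNormR R₀ H₀ 𝔬.blk hG.lenle (-1))
      (Dd U ν ∘ₗ 𝔬.G1 U ∘ₗ 𝔬.Qstar U) (fun y y' => (B₃ + θD * (B₃ * (1 - θ * c)⁻¹) * c) * Real.exp (-(r * g.dist y y'))) := by
    have h := hasMaj_toR_tgt hG hDQ
    simp only [Nat.cast_one] at h
    exact h
  have hDQT := hasMaj_transfer_weight hG (fun y => (hwZ y).le) hKQ' hST hDQR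
  have e2 : (-1 : ℝ) + 1 = 0 := by ring
  rw [e2] at hDQT
  have hGQ : HasMaj (weightNorm (BlockNorm.ofBlocks (toB6 g R₀ H₀) 𝔬.blkZ) (fun y => g.len y * wZ y) fun y => (wZlen_pos hG hwZ y).le)
      (BlockNorm.ofBlocks (toB6 g R₀ H₀) 𝔬.blk) (Dd U ν ∘ₗ 𝔬.G1 U ∘ₗ 𝔬.Qstar U)
      (fun a b => (B₃ + θD * (B₃ * (1 - θ * c)⁻¹) * c) * Λ * Real.exp (-((ρ₄ + 2 * σ) * g.dist a b))) :=
    hasMaj_of_out_zero (hDQT.of_rate_le hG.dnn (mul_nonneg hKQ' hΛ) hρ₂α)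
  -- (3.153)
  have h := GG_input_of_piecesFZ hG hrow hc hθ hB₀ hB₃ hBr (add_nonneg hBi (mul_nonneg (mul_nonneg (mul_nonneg hCL hΛ) hθH) hc))
    (add_nonneg hBd (mul_nonneg (mul_nonneg (mul_nonneg hCL hΛ) hθv) hc)) (mul_nonneg hKQ' hΛ) hσ hρ₄ le_rfl hρ₂r hρ₂₃σ hr hr0 hrK hq
    hK1 (hHR.e2d μ) hL hI (hLIM.domX ε hε0) (hLIM.locX ε hε0) (hLIM.rgdd μ ε hε0) hGop hGD hGQ
  refine h.mono fun a b => le_of_eq ?_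
  simp only [constI44]

omit [Fintype P] in
/-- ★ **(3.45) FOR 𝔊 = 𝔓G₁ PER DIRECTION PAIR, PRINTED SHAPE, COARSE LETTERS RE-CLASSED** (over `Letters313Z ∕ Letters313DMZ`, one free weight `wZ`) — Φ^X_β∘∇_{U,ν}𝔊∇\*_{U,μ} read from the input Hölder class `bHX (β+ε)` into the probe
blocks of X: ‖ζ∇_{U,ν}𝔊∇\*_{U,μ}λ‖_β-type bound K·(Lʲη)^{−β}·e^{−ρ₄d(y,y′)}(‖λ‖_{β+ε} + |λ|), K = `constI45 θ θ_H θ_v B₀ B₃ B_h B_i2 B_d2 B_q B_r Λ κ_W c`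
(the sibling's constant).  Route: (3.153) with E = Φ^X_β∘∇_{U,ν} in the real class 𝔠_P^{(β)} (`GG_input_of_piecesF`); Φ^X_β∇_νG₁∇\*_μ and Φ^X_β∇_νG₁Dv
by the right form (`input45_of_step` from Theorem 3.3's (3.45) per pair `Thm33G0Dir.h45m` ∕ the letter `Letters313IM.pdgDvd`, the steps `StepDir.tDd1` ∕
`Letters313IM.tDv`, the probe entry `B9Thm312WholeDir.probe43d_cNormR` from `Thm33G0Dir.h43d` ∕ `StepDir.pXd1`); Φ^X_β∇_νG₁Q\* by `hasMaj_left_rightR`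
(letters `Letters313DMZ.pQd`, `Letters313Z.gQs2`, the probe step `pXd1`) transferred by (2.60) to `Z_{len·wZ}`.  Provisos as for (3.44) — the per-pair twin of
`B9Thm313WholeInput.GG_input45_of_letters`.
[cite: Balaban1985BackgroundPropagators, Thm 3.13 p.426 + (3.153) p.426 + (3.45) p.398 + (3.39)–(3.40) p.397 + Thm 3.12 p.423 + p.398 (remark after (3.47)); Balaban1984PropagatorsII, Lemma 2.1 (2.60)–(2.61) p.234] -/
theorem GG_input45m_of_lettersZ (hG : GeoOK g) (𝔭 : HolderProbes g B X Y PX PY) {𝔬 : Ops g B X Y Z W} {U : B.Cfg}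
    {Dd Dds : B.Cfg → P → Module.End ℝ (X → ℝ)}
    {bHX : ℝ → BlockNorm (toB6 g R₀ H₀) (X → ℝ)} {bHW : ℝ → BlockNorm (toB6 g R₀ H₀) (W → ℝ)} {bH : BlockNorm (toB6 g R₀ H₀) (W → ℝ)}
    {Bh Bi Bq Bd : ℝ → ℝ} {Bi2 Bd2 : ℝ → ℝ → ℝ} {θ θD θH θv B₀ B₃ Br β δ₀ δ₃ δK r ρ₄ α Λ σ c ε : ℝ}
    (hrow : RowSum (toB6 g R₀ H₀) σ c)
    (hc : 0 ≤ c) (hθ : 0 ≤ θ) (hθH : 0 ≤ θH) (hθv : 0 ≤ θv) (hB₀ : 0 ≤ B₀) (hB₃ : 0 ≤ B₃) (hBh : 0 ≤ Bh β) (hBi2 : 0 ≤ Bi2 ε β)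
    (hBq : 0 ≤ Bq β) (hBd2 : 0 ≤ Bd2 ε β) (hBr : 0 ≤ Br) (hΛ : 0 ≤ Λ) (hα : 0 ≤ α) (hσ : 0 ≤ σ) (hε0 : 0 < ε) (hε1 : ε ≤ 1)
    (hβ0 : 0 ≤ β) (hβ1 : β < 1) (hρ₄ : 0 ≤ ρ₄) (hρ₄r : ρ₄ + 3 * σ ≤ (1 - α) * r) (hr : 0 ≤ r) (hr0 : r ≤ δ₀) (hr₃ : r ≤ δ₃)
    (hrK : r + σ ≤ δK) (hq : θ * c < 1) (hST : ScaleTransfer g r α Λ (fun y => g.len y ^ (1 : ℝ)))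
    (hK1 : HasMaj (cNorm R₀ H₀ 𝔬.blk hG.lenle 1) (cNorm R₀ H₀ 𝔬.blk hG.lenle 1) (𝔬.G0 U ∘ₗ (𝔬.Tpi U + 𝔬.T2 U))
      (fun a b => θ * Real.exp (-(δK * g.dist a b))))
    (hK2 : HasMaj (cNorm R₀ H₀ 𝔬.blk hG.lenle 2) (cNorm R₀ H₀ 𝔬.blk hG.lenle 2) (𝔬.G0 U ∘ₗ (𝔬.Tpi U + 𝔬.T2 U))
      (fun a b => θ * Real.exp (-(δK * g.dist a b))))
    (he0 : HasMajorant (g := toB6 g R₀ H₀) 𝔬.blk (𝔬.G0 U) (fun a b => B₀ * g.len a ^ 2 * Real.exp (-(δ₀ * g.dist a b))))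
    (hH0 : Thm33G0Dir 𝔬 𝔭 Dd Dds R₀ H₀ bHX B₀ Bh Bi Bi2 δ₀ U) (hHR : Thm33G0DirR 𝔬 Dds R₀ H₀ B₀ δ₀ U)
    (hSD : StepDir 𝔬 𝔭 Dd Dds R₀ H₀ bHX hG.lenle θD θH δK U)
    {wZ : g.Site → ℝ} {hwZ : ∀ y, 0 < wZ y}
    (hL : Letters313Z 𝔬 R₀ H₀ hG wZ hwZ B₃ δ₃ U) (hLDM : Letters313DMZ 𝔬 𝔭 Dd R₀ H₀ hG wZ hwZ B₃ Bq δ₃ bH U)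
    (hLIM : Letters313IM 𝔬 𝔭 Dd Dds R₀ H₀ hG.lenle bHX bHW Br θv Bd Bd2 δ₃ δK U) (hI : Identities 𝔬 U) (ν μ : P) :
    HasMaj (bHX (β + ε)) (BlockNorm.ofBlocks (toB6 g R₀ H₀) 𝔭.blkPX) ((𝔭.ΦX U β ∘ₗ Dd U ν) ∘ₗ (𝔬.GG U ∘ₗ Dds U μ))
      (fun (a b : g.Site) => constI45 θ θH θv B₀ B₃ (Bh β) (Bi2 ε β) (Bd2 ε β) (Bq β) Br Λ (bHW (β + ε)).κ c * g.len a ^ (-β) *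
        Real.exp (-(ρ₄ * g.dist a b))) := by
  -- adapted from `B9Thm313WholeInput.GG_input45_of_letters` (direction letters, X-inputs, X-probes)
  have htri : Triangle254 (toB6 g R₀ H₀) := fun a b c => hG.tri a b c
  have hfix1 := fix_of_inverses hI.invG0' hI.invG1
  have hfixR := fix_right_of_inverses hI.invG0' hI.invG1
  have hq1 : 0 ≤ (1 - θ * c)⁻¹ := inv_nonneg.mpr (by linarith)
  have hA₁ : 0 ≤ B₀ * (1 - θ * c)⁻¹ := mul_nonneg hB₀ hq1
  have hA₃ : 0 ≤ B₃ * (1 - θ * c)⁻¹ := mul_nonneg hB₃ hq1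
  have hCh : 0 ≤ Bh β + θH * (B₀ * (1 - θ * c)⁻¹) * c := add_nonneg hBh (mul_nonneg (mul_nonneg hθH hA₁) hc)
  have hKQ' : 0 ≤ Bq β + θH * (B₃ * (1 - θ * c)⁻¹) * c := add_nonneg hBq (mul_nonneg (mul_nonneg hθH hA₃) hc)
  -- rates
  have h1α : (1 - α) * r ≤ r := by rw [sub_mul, one_mul]; exact sub_le_self _ (mul_nonneg hα hr)
  have hρ₂0 : 0 ≤ ρ₄ + 2 * σ := by linarith
  have hρ₂σ : ρ₄ + 2 * σ + σ ≤ (1 - α) * r := by linarith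
  have hρ₂α : ρ₄ + 2 * σ ≤ (1 - α) * r := by linarith
  have hρ₂r : ρ₄ + 2 * σ ≤ r := by linarith
  have hρ₂K : ρ₄ + 2 * σ ≤ δK := by linarith
  have hρ₂0' : ρ₄ + 2 * σ ≤ δ₀ := by linarith
  have hρ₂₃ : ρ₄ + 2 * σ ≤ δ₃ := by linarith
  have hρ₂₃σ : ρ₄ + 2 * σ + σ ≤ δ₃ := by linarith
  set E : (X → ℝ) →ₗ[ℝ] (PX → ℝ) := 𝔭.ΦX U β ∘ₗ Dd U ν with hE
  -- the probe entry Φ^X_β∇_νG₁ : 𝔠^{(0)} → 𝔠_P^{(β−1)} at the rate r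
  have hA := probe43d_cNormR hG hrow hθ hθH hB₀ hBh hr hr0 hrK hK2 he0 (hH0.h43d ν β hβ0 hβ1) (hSD.pXd1 ν β hβ0 hβ1) hfix1 hq
  -- Φ∇_νG₁∇*_μ from `bHX (β+ε)` and Φ∇_νG₁Dv from `bHW (β+ε)` by the right form, into 𝔠_P^{(β)}
  have h45' : HasMaj (bHX (β + ε)) (BlockNorm.ofBlocks (toB6 g R₀ H₀) 𝔭.blkPX) (E ∘ₗ (𝔬.G0 U ∘ₗ Dds U μ))
      (fun (a b : g.Site) => Bi2 ε β * g.len a ^ (-β) * Real.exp (-(δ₀ * g.dist a b))) := hH0.h45m (ν, μ) ε β hε0 hε1 hβ0 hβ1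
  have hGop' := input45_of_step hG hrow hθH hBi2 hCh hΛ hρ₂0 hρ₂σ hρ₂K hρ₂0' hST hA h45' (hSD.tDd1 μ (β + ε) (by linarith)) hfixR
  have hGop : HasMaj (bHX (β + ε)) (cNormR R₀ H₀ 𝔭.blkPX hG.lenle β) (E ∘ₗ (𝔬.G1 U ∘ₗ Dds U μ))
      (fun a b => (Bi2 ε β + (Bh β + θH * (B₀ * (1 - θ * c)⁻¹) * c) * Λ * θH * c) * Real.exp (-((ρ₄ + 2 * σ) * g.dist a b))) :=
    hasMaj_weight_out hG (hGop'.mono fun a b => le_of_eq (by ring))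
  have hε' : 0 < β + ε := by linarith
  have hpd : HasMaj (bHW (β + ε)) (BlockNorm.ofBlocks (toB6 g R₀ H₀) 𝔭.blkPX) (E ∘ₗ (𝔬.G0 U ∘ₗ 𝔬.Dv U))
      (fun (a b : g.Site) => Bd2 ε β * g.len a ^ (-β) * Real.exp (-(δ₃ * g.dist a b))) := hLIM.pdgDvd ν ε β hε0 hε1 hβ0 hβ1
  have hGD' := input45_of_step hG hrow hθv hBd2 hCh hΛ hρ₂0 hρ₂σ hρ₂K hρ₂₃ hST hA hpd (hLIM.tDv (β + ε) hε') hfixR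
  have hGD : HasMaj (bHW (β + ε)) (cNormR R₀ H₀ 𝔭.blkPX hG.lenle β) (E ∘ₗ (𝔬.G1 U ∘ₗ 𝔬.Dv U))
      (fun a b => (Bd2 ε β + (Bh β + θH * (B₀ * (1 - θ * c)⁻¹) * c) * Λ * θv * c) * Real.exp (-((ρ₄ + 2 * σ) * g.dist a b))) :=
    hasMaj_weight_out hG (hGD'.mono fun a b => le_of_eq (by ring))
  -- Φ∇_νG₁Q* : Z_{wZ} → 𝔠_P^{(β−1)} by the left form over the real middle class 𝔠^{(−2)}, then (2.60): Z_{len·wZ} → 𝔠_P^{(β)}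
  have hGQr : HasMaj (weightNorm (BlockNorm.ofBlocks (toB6 g R₀ H₀) 𝔬.blkZ) wZ fun y => (hwZ y).le) (cNormR R₀ H₀ 𝔬.blk hG.lenle (-2))
      (𝔬.G1 U ∘ₗ 𝔬.Qstar U) (fun a b => B₃ * (1 - θ * c)⁻¹ * Real.exp (-(r * g.dist a b))) := by
    have h := hasMaj_toR_tgt hG (hasMaj_right_of_step_weight hG hwZ hrow hθ hB₃ hr hr₃ hrK hK2 hL.gQs2 hfix1 hq)
    simp only [Nat.cast_ofNat] at h
    exact h
  have hpQ' : HasMaj (weightNorm (BlockNorm.ofBlocks (toB6 g R₀ H₀) 𝔬.blkZ) wZ fun y => (hwZ y).le) (cNormR R₀ H₀ 𝔭.blkPX hG.lenle (β - 1))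
      (E ∘ₗ 𝔬.G0 U ∘ₗ 𝔬.Qstar U) (fun a b => Bq β * Real.exp (-(δ₃ * g.dist a b))) := hLDM.pQd ν β hβ0 hβ1
  have hKE : HasMaj (cNormR R₀ H₀ 𝔬.blk hG.lenle (-2)) (cNormR R₀ H₀ 𝔭.blkPX hG.lenle (β - 1))
      (E ∘ₗ 𝔬.G0 U ∘ₗ (𝔬.Tpi U + 𝔬.T2 U)) (fun a b => θH * Real.exp (-(δK * g.dist a b))) := hSD.pXd1 ν β hβ0 hβ1
  have hDQ := hasMaj_left_rightR hG hrow hθH hBq hA₃ hr hr₃ le_rfl hrK hKE hpQ' hGQr hfix1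
  have hDQT := hasMaj_transfer_weight hG (fun y => (hwZ y).le) hKQ' hST hDQ
  have e2 : β - 1 + 1 = β := by ring
  rw [e2] at hDQT
  have hGQ : HasMaj (weightNorm (BlockNorm.ofBlocks (toB6 g R₀ H₀) 𝔬.blkZ) (fun y => g.len y * wZ y) fun y => (wZlen_pos hG hwZ y).le)
      (cNormR R₀ H₀ 𝔭.blkPX hG.lenle β) (E ∘ₗ 𝔬.G1 U ∘ₗ 𝔬.Qstar U)
      (fun a b => (Bq β + θH * (B₃ * (1 - θ * c)⁻¹) * c) * Λ * Real.exp (-((ρ₄ + 2 * σ) * g.dist a b))) :=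
    hDQT.of_rate_le hG.dnn (mul_nonneg hKQ' hΛ) hρ₂α
  -- (3.153) in 𝔠_P^{(β)}, then unweighted
  have h := GG_input_of_piecesFZ hG hrow hc hθ hB₀ hB₃ hBr (add_nonneg hBi2 (mul_nonneg (mul_nonneg (mul_nonneg hCh hΛ) hθH) hc))
    (add_nonneg hBd2 (mul_nonneg (mul_nonneg (mul_nonneg hCh hΛ) hθv) hc)) (mul_nonneg hKQ' hΛ) hσ hρ₄ le_rfl hρ₂r hρ₂₃σ hr hr0 hrK hq
    hK1 (hHR.e2d μ) hL hI (hLIM.domX (β + ε) hε') (hLIM.locX (β + ε) hε') (hLIM.rgdd μ (β + ε) hε') hGop hGD hGQ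
  have hu := hasMaj_unweight_out hG h
  refine hu.mono fun a b => le_of_eq ?_
  simp only [constI45]
  ring

/-- ★ **(3.44) FOR 𝔊 ON THE PACKAGED PAIR FAMILY, COARSE LETTERS RE-CLASSED** (over `Letters313Z ∕ Letters313DMZ`, one free weight `wZ`) — `GG_input44m_of_lettersZ` for every pair, packaged WITHOUT a |P| factor (`hasMaj_familyOp'`: sup sizes):
the family `familyOp (q ↦ ∇_{U,q.1} ∘ 𝔊 ∘ ∇\*_{U,q.2})` read from `bHX ε` into the sharp blocks of X × (P × P) (block map `blk ∘ Prod.fst`) — the input `h44`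
of n06-k's `lines3445_of_hasMaj_fam` for 𝔊's kernel family. [cite: Balaban1985BackgroundPropagators, Thm 3.13 p.426 + (3.44) p.398 + (3.39) p.397] -/
theorem GG_input44Family_of_lettersZ (hG : GeoOK g) (𝔭 : HolderProbes g B X Y PX PY) {𝔬 : Ops g B X Y Z W} {U : B.Cfg}
    {Dd Dds : B.Cfg → P → Module.End ℝ (X → ℝ)}
    {bHX : ℝ → BlockNorm (toB6 g R₀ H₀) (X → ℝ)} {bHW : ℝ → BlockNorm (toB6 g R₀ H₀) (W → ℝ)} {bH : BlockNorm (toB6 g R₀ H₀) (W → ℝ)}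
    {Bh Bi Bq Bd : ℝ → ℝ} {Bi2 Bd2 : ℝ → ℝ → ℝ} {θ θD θH θv B₀ B₃ Br δ₀ δ₃ δK r ρ₄ α Λ σ c ε : ℝ} (hrow : RowSum (toB6 g R₀ H₀) σ c)
    (hc : 0 ≤ c) (hθ : 0 ≤ θ) (hθD : 0 ≤ θD) (hθH : 0 ≤ θH) (hθv : 0 ≤ θv) (hB₀ : 0 ≤ B₀) (hB₃ : 0 ≤ B₃) (hBi : 0 ≤ Bi ε)
    (hBd : 0 ≤ Bd ε) (hBr : 0 ≤ Br) (hΛ : 0 ≤ Λ) (hα : 0 ≤ α) (hσ : 0 ≤ σ) (hε0 : 0 < ε) (hε1 : ε ≤ 1) (hρ₄ : 0 ≤ ρ₄)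
    (hρ₄r : ρ₄ + 3 * σ ≤ (1 - α) * r) (hr : 0 ≤ r) (hr0 : r ≤ δ₀) (hr₃ : r ≤ δ₃) (hrK : r + σ ≤ δK) (hq : θ * c < 1)
    (hST : ScaleTransfer g r α Λ (fun y => g.len y ^ (1 : ℝ)))
    (hK1 : HasMaj (cNorm R₀ H₀ 𝔬.blk hG.lenle 1) (cNorm R₀ H₀ 𝔬.blk hG.lenle 1) (𝔬.G0 U ∘ₗ (𝔬.Tpi U + 𝔬.T2 U))
      (fun a b => θ * Real.exp (-(δK * g.dist a b))))
    (hK2 : HasMaj (cNorm R₀ H₀ 𝔬.blk hG.lenle 2) (cNorm R₀ H₀ 𝔬.blk hG.lenle 2) (𝔬.G0 U ∘ₗ (𝔬.Tpi U + 𝔬.T2 U))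
      (fun a b => θ * Real.exp (-(δK * g.dist a b))))
    (he0 : HasMajorant (g := toB6 g R₀ H₀) 𝔬.blk (𝔬.G0 U) (fun a b => B₀ * g.len a ^ 2 * Real.exp (-(δ₀ * g.dist a b))))
    (hH0 : Thm33G0Dir 𝔬 𝔭 Dd Dds R₀ H₀ bHX B₀ Bh Bi Bi2 δ₀ U) (hHR : Thm33G0DirR 𝔬 Dds R₀ H₀ B₀ δ₀ U)
    (hSD : StepDir 𝔬 𝔭 Dd Dds R₀ H₀ bHX hG.lenle θD θH δK U)
    {wZ : g.Site → ℝ} {hwZ : ∀ y, 0 < wZ y}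
    (hL : Letters313Z 𝔬 R₀ H₀ hG wZ hwZ B₃ δ₃ U) (hLDM : Letters313DMZ 𝔬 𝔭 Dd R₀ H₀ hG wZ hwZ B₃ Bq δ₃ bH U)
    (hLIM : Letters313IM 𝔬 𝔭 Dd Dds R₀ H₀ hG.lenle bHX bHW Br θv Bd Bd2 δ₃ δK U) (hI : Identities 𝔬 U) :
    HasMaj (bHX ε) (BlockNorm.ofBlocks (toB6 g R₀ H₀) (𝔬.blk ∘ Prod.fst))
      (familyOp (fun q : P × P => Dd U q.1 ∘ₗ (𝔬.GG U ∘ₗ Dds U q.2)))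
      (fun (a b : g.Site) => constI44 θ θD θH θv B₀ B₃ (Bi ε) (Bd ε) Br Λ (bHW ε).κ c * Real.exp (-(ρ₄ * g.dist a b))) := by
  have hq1 : 0 ≤ (1 - θ * c)⁻¹ := inv_nonneg.mpr (by linarith)
  have hK0 : 0 ≤ constI44 θ θD θH θv B₀ B₃ (Bi ε) (Bd ε) Br Λ (bHW ε).κ c := by
    have hκ := (bHW ε).κ_nonneg
    unfold constI44
    positivity
  exact hasMaj_familyOp' (R := R₀) (H := H₀) 𝔬.blk (fun a b => mul_nonneg hK0 (Real.exp_nonneg _))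
    fun q => GG_input44m_of_lettersZ hG 𝔭 hrow hc hθ hθD hθH hθv hB₀ hB₃ hBi hBd hBr hΛ hα hσ hε0 hε1 hρ₄ hρ₄r hr hr0 hr₃ hrK hq
      hST hK1 hK2 he0 hH0 hHR hSD hL hLDM hLIM hI q.1 q.2

/-- ★ **(3.45) FOR 𝔊 ON THE PACKAGED PAIR FAMILY, PROBES SLICED, COARSE LETTERS RE-CLASSED** (over `Letters313Z ∕ Letters313DMZ`, one free weight `wZ`) — `GG_input45m_of_lettersZ` for every pair, the X-probes sliced over the family
(`sliceProbe_comp_familyOp`) and packaged without a |P| factor (`hasMaj_familyOp'`): `sliceProbe Φ^X_β ∘ familyOp (q ↦ ∇_{U,q.1}𝔊∇\*_{U,q.2})` read from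
`bHX (β+ε)` into the probe blocks (block map `blkPX ∘ Prod.fst`) — the input `h45` of n06-k's `lines3445_of_hasMaj_fam` for 𝔊's kernel family.
[cite: Balaban1985BackgroundPropagators, Thm 3.13 p.426 + (3.45) p.398 + (3.39)–(3.40) p.397] -/
theorem GG_input45Family_of_lettersZ (hG : GeoOK g) (𝔭 : HolderProbes g B X Y PX PY) {𝔬 : Ops g B X Y Z W} {U : B.Cfg}
    {Dd Dds : B.Cfg → P → Module.End ℝ (X → ℝ)}
    {bHX : ℝ → BlockNorm (toB6 g R₀ H₀) (X → ℝ)} {bHW : ℝ → BlockNorm (toB6 g R₀ H₀) (W → ℝ)} {bH : BlockNorm (toB6 g R₀ H₀) (W → ℝ)}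
    {Bh Bi Bq Bd : ℝ → ℝ} {Bi2 Bd2 : ℝ → ℝ → ℝ} {θ θD θH θv B₀ B₃ Br β δ₀ δ₃ δK r ρ₄ α Λ σ c ε : ℝ}
    (hrow : RowSum (toB6 g R₀ H₀) σ c)
    (hc : 0 ≤ c) (hθ : 0 ≤ θ) (hθH : 0 ≤ θH) (hθv : 0 ≤ θv) (hB₀ : 0 ≤ B₀) (hB₃ : 0 ≤ B₃) (hBh : 0 ≤ Bh β) (hBi2 : 0 ≤ Bi2 ε β)
    (hBq : 0 ≤ Bq β) (hBd2 : 0 ≤ Bd2 ε β) (hBr : 0 ≤ Br) (hΛ : 0 ≤ Λ) (hα : 0 ≤ α) (hσ : 0 ≤ σ) (hε0 : 0 < ε) (hε1 : ε ≤ 1)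
    (hβ0 : 0 ≤ β) (hβ1 : β < 1) (hρ₄ : 0 ≤ ρ₄) (hρ₄r : ρ₄ + 3 * σ ≤ (1 - α) * r) (hr : 0 ≤ r) (hr0 : r ≤ δ₀) (hr₃ : r ≤ δ₃)
    (hrK : r + σ ≤ δK) (hq : θ * c < 1) (hST : ScaleTransfer g r α Λ (fun y => g.len y ^ (1 : ℝ)))
    (hK1 : HasMaj (cNorm R₀ H₀ 𝔬.blk hG.lenle 1) (cNorm R₀ H₀ 𝔬.blk hG.lenle 1) (𝔬.G0 U ∘ₗ (𝔬.Tpi U + 𝔬.T2 U))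
      (fun a b => θ * Real.exp (-(δK * g.dist a b))))
    (hK2 : HasMaj (cNorm R₀ H₀ 𝔬.blk hG.lenle 2) (cNorm R₀ H₀ 𝔬.blk hG.lenle 2) (𝔬.G0 U ∘ₗ (𝔬.Tpi U + 𝔬.T2 U))
      (fun a b => θ * Real.exp (-(δK * g.dist a b))))
    (he0 : HasMajorant (g := toB6 g R₀ H₀) 𝔬.blk (𝔬.G0 U) (fun a b => B₀ * g.len a ^ 2 * Real.exp (-(δ₀ * g.dist a b))))
    (hH0 : Thm33G0Dir 𝔬 𝔭 Dd Dds R₀ H₀ bHX B₀ Bh Bi Bi2 δ₀ U) (hHR : Thm33G0DirR 𝔬 Dds R₀ H₀ B₀ δ₀ U)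
    (hSD : StepDir 𝔬 𝔭 Dd Dds R₀ H₀ bHX hG.lenle θD θH δK U)
    {wZ : g.Site → ℝ} {hwZ : ∀ y, 0 < wZ y}
    (hL : Letters313Z 𝔬 R₀ H₀ hG wZ hwZ B₃ δ₃ U) (hLDM : Letters313DMZ 𝔬 𝔭 Dd R₀ H₀ hG wZ hwZ B₃ Bq δ₃ bH U)
    (hLIM : Letters313IM 𝔬 𝔭 Dd Dds R₀ H₀ hG.lenle bHX bHW Br θv Bd Bd2 δ₃ δK U) (hI : Identities 𝔬 U) :
    HasMaj (bHX (β + ε)) (BlockNorm.ofBlocks (toB6 g R₀ H₀) (𝔭.blkPX ∘ Prod.fst))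
      (sliceProbe (𝔭.ΦX U β) ∘ₗ familyOp (fun q : P × P => Dd U q.1 ∘ₗ (𝔬.GG U ∘ₗ Dds U q.2)))
      (fun (a b : g.Site) => constI45 θ θH θv B₀ B₃ (Bh β) (Bi2 ε β) (Bd2 ε β) (Bq β) Br Λ (bHW (β + ε)).κ c * g.len a ^ (-β) *
        Real.exp (-(ρ₄ * g.dist a b))) := by
  have hq1 : 0 ≤ (1 - θ * c)⁻¹ := inv_nonneg.mpr (by linarith)
  have hK0 : 0 ≤ constI45 θ θH θv B₀ B₃ (Bh β) (Bi2 ε β) (Bd2 ε β) (Bq β) Br Λ (bHW (β + ε)).κ c := by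
    have hκ := (bHW (β + ε)).κ_nonneg
    unfold constI45
    positivity
  rw [sliceProbe_comp_familyOp]
  refine hasMaj_familyOp' (R := R₀) (H := H₀) 𝔭.blkPX
    (fun a b => mul_nonneg (mul_nonneg hK0 (Real.rpow_nonneg (hG.lenle a) _)) (Real.exp_nonneg _)) fun q => ?_
  have h := GG_input45m_of_lettersZ hG 𝔭 hrow hc hθ hθH hθv hB₀ hB₃ hBh hBi2 hBq hBd2 hBr hΛ hα hσ hε0 hε1 hβ0 hβ1 hρ₄ hρ₄r hr hr0
    hr₃ hrK hq hST hK1 hK2 he0 hH0 hHR hSD hL hLDM hLIM hI q.1 q.2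
  exact h.congr fun μ => rfl

end OneMember

end

end Literature.MathematicalPhysics.QuantumFieldTheory.Balaban1983to89.B9Thm313WholeDirInputZ
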